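import Literature.Computability.Complexity.FKPointLocationProtocolLift
import HarnessLib

/-!
# Fournier–Koiran point location, VIII: the phases of a level

Topic `Literature/Computability/Complexity`, grouping namespace `FKPointLocation`. Bookkeeping lemmas
for the protocol of `FKPointLocationProtocol.lean`: what running the tasks of ONE phase of a level
does to the state, in terms of the truthful answers — binary search (`run_bs_coord`, `run_bs`),
the chain slots and scales (`run_slot`, `run_scale`, `run_scales`), the apex search (`run_ap`), the
equality tests (`run_eq`), and the facet comparisons (`run_fa`). Each lemma takes the semantic
evaluation of the answers as a hypothesis about `truth` on states of the phase's shape; the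
hypotheses are discharged from `sign_aff_liftAll` and the level mathematics in
`FKPointLocationProtocolValid.lean`.

## References

* H. Fournier, P. Koiran, *Lower bounds are not easier over the reals: inside PH*, ICALP 2000,
  LNCS 1853 = LIP RR-1999-21, §2.1 Steps 1 and k. [FournierKoiran2000]
-/

namespace Literature.Computability.Complexity

namespace FKPointLocation

open Finset

variable (Q : LevelParams) {finT : Cert Q.D → Prop} {xh : Fin Q.D → ℝ}

/-! ### Setting scratch fields -/

namespace Data

variable {Q}

/-- Replace the scratch. [folklore] -/
def withCur (dat : Data Q.D) (c : Scratch Q.D) : Data Q.D := { dat with cur := c }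

/-- Unfolding of `withCur` (`withCur_cur`). [folklore] -/
@[simp] theorem withCur_cur (dat : Data Q.D) (c : Scratch Q.D) : (dat.withCur c).cur = c := rfl
/-- Unfolding of `withCur` (`withCur_done`). [folklore] -/
@[simp] theorem withCur_done (dat : Data Q.D) (c : Scratch Q.D) : (dat.withCur c).done = dat.done := rfl
/-- Unfolding of `withCur` (`withCur_out`). [folklore] -/
@[simp] theorem withCur_out (dat : Data Q.D) (c : Scratch Q.D) : (dat.withCur c).out = dat.out := rfl
/-- Unfolding of `withCur` (`withCur_chart`). [folklore] -/
@[simp] theorem withCur_chart (dat : Data Q.D) (c : Scratch Q.D) : (dat.withCur c).chart = dat.chart := rfl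
/-- Unfolding of `withCur` (`withCur_levels`). [folklore] -/
@[simp] theorem withCur_levels (dat : Data Q.D) (c : Scratch Q.D) : (dat.withCur c).levels = dat.levels := rfl
/-- Unfolding of `withCur` (`withCur_withCur`). [folklore] -/
@[simp] theorem withCur_withCur (dat : Data Q.D) (c c' : Scratch Q.D) : (dat.withCur c).withCur c' = dat.withCur c' := rfl
/-- Unfolding of `withCur` (`withCur_self`). [folklore] -/
@[simp] theorem withCur_self (dat : Data Q.D) : dat.withCur dat.cur = dat := rfl
/-- Unfolding of `withCur` (`hist_withCur`). [folklore] -/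
@[simp] theorem hist_withCur (dat : Data Q.D) (c : Scratch Q.D) : (dat.withCur c).hist = dat.hist := rfl
/-- Unfolding of `withCur` (`ctx_withCur`). [folklore] -/
@[simp] theorem ctx_withCur (dat : Data Q.D) (c : Scratch Q.D) : (dat.withCur c).ctx = ⟨dat.chart, dat.levels.map fun r => r.apex.1, c.m⟩ := rfl

end Data

/-! ### Binary search -/

section BS

variable {Q}

/-- The update of a binary-search task on a FIXED coordinate. [folklore] -/
theorem upd_bs_fixed (dat : Data Q.D) (hdone : dat.done = false) {i : Fin Q.D} (hi : dat.chart i ≠ 0) (k : ℕ) (b : Bool) :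
    upd Q dat (Task.bs i k) b =
      if k = Q.L then dat.withCur { dat.cur with m := Function.update dat.cur.m i (dat.chart i * 2 ^ (Q.L + 1)), bsAcc := 0 }
      else dat := by
  simp [upd, hdone, hi, Data.withCur]

/-- The update of a binary-search task on a FREE coordinate. [folklore] -/
theorem upd_bs_free (dat : Data Q.D) (hdone : dat.done = false) {i : Fin Q.D} (hi : dat.chart i = 0) (k : ℕ) (b : Bool) :
    upd Q dat (Task.bs i k) b =
      if k = Q.L then
        dat.withCur { dat.cur with
          m := Function.update dat.cur.m i (2 * ((2 * (if k = 0 then 0 else dat.cur.bsAcc) + b.toNat : ℕ) : ℤ) + 1 - 2 ^ (Q.L + 1)),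
          bsAcc := 0 }
      else dat.withCur { dat.cur with bsAcc := 2 * (if k = 0 then 0 else dat.cur.bsAcc) + b.toNat } := by
  simp [upd, hdone, hi, Data.withCur]

/-- The numerator recursion realised by the rounds. [folklore] -/
theorem bs_round_acc (v : ℝ) (k : ℕ) :
    2 * (if k = 0 then 0 else (bsRun v k).2) +
        (decide ((-1 : ℝ) + (2 * ((if k = 0 then 0 else (bsRun v k).2 : ℕ) : ℝ) + 1) / 2 ^ k ≤ v)).toNat =
      (bsRun v (k + 1)).2 := by
  have h0 : (if k = 0 then 0 else (bsRun v k).2) = (bsRun v k).2 := by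
    split_ifs with h
    · subst h; rfl
    · rfl
  rw [h0, bsRun_succ_snd]
  by_cases hc : (-1 : ℝ) + (2 * ((bsRun v k).2 : ℝ) + 1) / 2 ^ k ≤ v
  · rw [decide_eq_true hc, if_pos hc]; rfl
  · rw [decide_eq_false hc, if_neg hc]; rfl

/-- **Binary search of one FREE coordinate**: `L+1` rounds compute `bsCentreNum v L` into `m i`,
provided each round's answer is the binary-search test of `v`. [cite: FournierKoiran2000, §2.1 Step 1] -/
theorem run_bs_free (dat : Data Q.D) (hdone : dat.done = false) {i : Fin Q.D} (hi : dat.chart i = 0)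
    (hacc0 : dat.cur.bsAcc = 0) (v : ℝ)
    (htruth : ∀ (c : Scratch Q.D) (k : ℕ), k ≤ Q.L →
      truth finT (certOf Q) xh (dat.withCur c) (Task.bs i k) =
        decide ((-1 : ℝ) + (2 * ((if k = 0 then 0 else c.bsAcc : ℕ) : ℝ) + 1) / 2 ^ k ≤ v)) :
    runFrom Q finT xh dat ((List.range (Q.L + 1)).map (Task.bs i)) =
      dat.withCur { dat.cur with m := Function.update dat.cur.m i (bsCentreNum v Q.L), bsAcc := 0 } := by
  -- after `k ≤ L` rounds: `bsAcc = (bsRun v k).2`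
  have key : ∀ k, k ≤ Q.L →
      runFrom Q finT xh dat ((List.range k).map (Task.bs i)) = dat.withCur { dat.cur with bsAcc := (bsRun v k).2 } := by
    intro k hkL
    induction k with
    | zero =>
      simp only [List.range_zero, List.map_nil, runFrom_nil, bsRun_zero]
      rw [← hacc0]
      rfl
    | succ k ih =>
      rw [List.range_succ, List.map_append, List.map_singleton, runFrom_append, runFrom_cons, runFrom_nil,
        ih (by omega), step, htruth _ k (by omega),
        upd_bs_free _ (by rw [Data.withCur_done]; exact hdone) (by rw [Data.withCur_chart]; exact hi), if_neg (by omega)]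
      simp only [Data.withCur_cur, Data.withCur_withCur]
      rw [bs_round_acc v k]
  rw [List.range_succ, List.map_append, List.map_singleton, runFrom_append, runFrom_cons, runFrom_nil,
    key Q.L le_rfl, step, htruth _ Q.L le_rfl,
    upd_bs_free _ (by rw [Data.withCur_done]; exact hdone) (by rw [Data.withCur_chart]; exact hi), if_pos rfl]
  simp only [Data.withCur_cur, Data.withCur_withCur]
  rw [bs_round_acc v Q.L]
  rfl

/-- **Binary search of one FIXED coordinate**: the rounds are idle and `m i := χ_i 2^{L+1}`. [folklore] -/
theorem run_bs_fixed (dat : Data Q.D) (hdone : dat.done = false) {i : Fin Q.D} (hi : dat.chart i ≠ 0) :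
    runFrom Q finT xh dat ((List.range (Q.L + 1)).map (Task.bs i)) =
      dat.withCur { dat.cur with m := Function.update dat.cur.m i (dat.chart i * 2 ^ (Q.L + 1)), bsAcc := 0 } := by
  have key : ∀ k, k ≤ Q.L → runFrom Q finT xh dat ((List.range k).map (Task.bs i)) = dat := by
    intro k hk
    induction k with
    | zero => rfl
    | succ k ih =>
      rw [List.range_succ, List.map_append, List.map_singleton, runFrom_append, runFrom_cons, runFrom_nil,
        ih (by omega), step, upd_bs_fixed dat hdone hi, if_neg (by omega)]
  rw [List.range_succ, List.map_append, List.map_singleton, runFrom_append, runFrom_cons, runFrom_nil,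
    key Q.L le_rfl, step, upd_bs_fixed dat hdone hi, if_pos rfl]

end BS

end FKPointLocation

end Literature.Computability.Complexity

namespace Literature.Computability.Complexity

namespace FKPointLocation

open Finset

variable (Q : LevelParams) {finT : Cert Q.D → Prop} {xh : Fin Q.D → ℝ}

/-! ### Binary search of all coordinates -/

section BSAll

variable {Q}

/-- **The binary-search phase**: every coordinate's numerator is set (fixed ones to `χ_i 2^{L+1}`,
free ones to `bsCentreNum (v i) L`). [cite: FournierKoiran2000, §2.1 Step 1 ("by binary search on each coordinate, we find a little cube")] -/
theorem run_bs (dat : Data Q.D) (hdone : dat.done = false) (hacc0 : dat.cur.bsAcc = 0) (v : Fin Q.D → ℝ)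
    (htruth : ∀ (c : Scratch Q.D) (i : Fin Q.D) (k : ℕ), k ≤ Q.L → dat.chart i = 0 →
      truth finT (certOf Q) xh (dat.withCur c) (Task.bs i k) =
        decide ((-1 : ℝ) + (2 * ((if k = 0 then 0 else c.bsAcc : ℕ) : ℝ) + 1) / 2 ^ k ≤ v i)) :
    ∀ l : List (Fin Q.D),
      runFrom Q finT xh dat (l.flatMap fun i => (List.range (Q.L + 1)).map (Task.bs i)) =
        dat.withCur { dat.cur with
          m := fun i => if i ∈ l then (if dat.chart i ≠ 0 then dat.chart i * 2 ^ (Q.L + 1) else bsCentreNum (v i) Q.L)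
            else dat.cur.m i,
          bsAcc := 0 } := by
  intro l
  induction l generalizing dat with
  | nil =>
    simp only [List.flatMap_nil, runFrom_nil, List.not_mem_nil, if_false]
    rw [← hacc0]; rfl
  | cons i l ih =>
    rw [List.flatMap_cons, runFrom_append]
    by_cases hi : dat.chart i = 0
    · rw [run_bs_free dat hdone hi hacc0 (v i) (fun c k hk => htruth c i k hk hi),
        ih (dat.withCur { dat.cur with m := Function.update dat.cur.m i (bsCentreNum (v i) Q.L), bsAcc := 0 })
          hdone rfl (fun c i' k hk hi' => htruth c i' k hk hi')]
      simp only [Data.withCur_cur, Data.withCur_withCur, Data.withCur_chart]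
      congr 1
      congr 1
      funext i'
      by_cases h1 : i' = i
      · subst h1; simp [hi]
      · simp [h1]
    · rw [run_bs_fixed dat hdone hi,
        ih (dat.withCur { dat.cur with m := Function.update dat.cur.m i (dat.chart i * 2 ^ (Q.L + 1)), bsAcc := 0 })
          hdone rfl (fun c i' k hk hi' => htruth c i' k hk hi')]
      simp only [Data.withCur_cur, Data.withCur_withCur, Data.withCur_chart]
      congr 1
      congr 1
      funext i'
      by_cases h1 : i' = i
      · subst h1; simp [hi]
      · simp [h1]

end BSAll

/-! ### Chain slots and scales -/

section SC

variable {Q}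

/-- The scratch states of the search phases: base scratch with given stable / chain / exOk / bits.
[folklore] -/
def scSt (base : Scratch Q.D) (st : Option (ℕ × List (Fin Q.D → ℤ))) (ch : List (Fin Q.D → ℤ)) (e : Bool)
    (bs : List Bool) : Scratch Q.D :=
  { base with stable := st, chain := ch, exOk := e, bits := bs }

/-- Update of an existence task. [folklore] -/
theorem upd_ex (dat : Data Q.D) (hdone : dat.done = false) (sc m : ℕ) (b : Bool) :
    upd Q dat (Task.ex sc m) b = dat.withCur { dat.cur with exOk := b, bits := [] } := by
  simp [upd, hdone, Data.withCur]

/-- Update of a prefix task when the slot is idle. [folklore] -/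
theorem upd_pf_false (dat : Data Q.D) (hdone : dat.done = false) (hex : dat.cur.exOk = false) (sc m w : ℕ) (b : Bool) :
    upd Q dat (Task.pf sc m w) b = dat := by
  simp [upd, hdone, hex]

/-- Update of a prefix task when the slot is active. [folklore] -/
theorem upd_pf_true (dat : Data Q.D) (hdone : dat.done = false) (hex : dat.cur.exOk = true) (sc m w : ℕ) (b : Bool) :
    upd Q dat (Task.pf sc m w) b =
      if w + 1 = Q.Wf then
        dat.withCur { dat.cur with chain := dat.cur.chain ++ [decodeForm Q.bB Q.D (dat.cur.bits ++ [b])], bits := [], exOk := false }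
      else dat.withCur { dat.cur with bits := dat.cur.bits ++ [b] } := by
  simp [upd, hdone, hex, Data.withCur]

/-- Update of a stability task. [folklore] -/
theorem upd_st (dat : Data Q.D) (hdone : dat.done = false) (sc : ℕ) (b : Bool) :
    upd Q dat (Task.st sc) b =
      dat.withCur { dat.cur with
        stable := (match dat.cur.stable with | some p => some p | none => if b then none else some (sc, dat.cur.chain)),
        chain := [], bits := [], exOk := false } := by
  -- case on the scrutinee, so that the two (module-local) matchers both reduce
  rcases hs : dat.cur.stable with _ | p
  · cases b <;> simp [upd, hdone, Data.withCur, hs]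
  · simp [upd, hdone, Data.withCur, hs]

open Classical in
/-- The truth of an NP task is its statement. [folklore] -/
theorem truth_of_not_isSign (dat : Data Q.D) (τ : Task Q.D) (h : τ.isSign = false) :
    truth finT (certOf Q) xh dat τ = decide (npTruth finT (certOf Q) dat τ) := by
  rw [truth, h]; rfl

/-- `Wf ≥ 1`. [folklore] -/
theorem one_le_Wf : 1 ≤ Q.Wf := by
  have := Q.D_pos
  unfold LevelParams.Wf
  exact Nat.mul_pos this (Nat.succ_pos _)

/-- `Wa ≥ 1`. [folklore] -/
theorem one_le_Wa : 1 ≤ Q.Wa := by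
  have := Q.D_pos
  unfold LevelParams.Wa
  have : 1 ≤ Q.D * (Q.W + 1) := Nat.mul_pos this (Nat.succ_pos _)
  omega

/-- **The prefix tasks of an ACTIVE slot** compute `prefixSearch` of the slot's predicate and append
the decoded form. [cite: FournierKoiran2000, §2.1 (prefix search for `h`)] -/
theorem run_pf_active (dat : Data Q.D) (hdone : dat.done = false) (base : Scratch Q.D)
    (st : Option (ℕ × List (Fin Q.D → ℤ))) (ch : List (Fin Q.D → ℤ)) (sc m : ℕ) :
    let Λ : LevelCtx Q := ⟨dat.chart, dat.levels.map fun r => r.apex.1, base.m⟩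
    runFrom Q finT xh (dat.withCur (scSt base st ch true [])) ((List.range Q.Wf).map (Task.pf sc m)) =
      dat.withCur (scSt base st (ch ++ [decodeForm Q.bB Q.D (prefixSearch (Λ.FormP sc ch) Q.Wf Q.Wf [])]) false []) := by
  intro Λ
  have key : ∀ w, w < Q.Wf →
      runFrom Q finT xh (dat.withCur (scSt base st ch true [])) ((List.range w).map (Task.pf sc m)) =
        dat.withCur (scSt base st ch true (prefixSearch (Λ.FormP sc ch) Q.Wf w [])) := by
    intro w hw
    induction w with
    | zero => rfl
    | succ w ih =>
      rw [List.range_succ, List.map_append, List.map_singleton, runFrom_append, runFrom_cons, runFrom_nil,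
        ih (by omega), step, truth_of_not_isSign _ _ rfl, upd_pf_true _ (by rw [Data.withCur_done]; exact hdone) rfl,
        if_neg (by omega), prefixSearch_succ_right]
      rfl
  obtain ⟨W', hW'⟩ : ∃ W', Q.Wf = W' + 1 := ⟨Q.Wf - 1, by have := one_le_Wf (Q := Q); omega⟩
  rw [hW', List.range_succ, List.map_append, List.map_singleton, runFrom_append, runFrom_cons, runFrom_nil,
    ← hW', key W' (by omega), step, truth_of_not_isSign _ _ rfl,
    upd_pf_true _ (by rw [Data.withCur_done]; exact hdone) rfl, if_pos hW'.symm,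
    show prefixSearch (Λ.FormP sc ch) Q.Wf Q.Wf [] = prefixStep (Λ.FormP sc ch) Q.Wf (prefixSearch (Λ.FormP sc ch) Q.Wf W' []) by
      rw [hW']; exact prefixSearch_succ_right _ _ _ _]
  rfl

/-- The prefix tasks of an IDLE slot do nothing. [folklore] -/
theorem run_pf_idle (dat : Data Q.D) (hdone : dat.done = false) (base : Scratch Q.D)
    (st : Option (ℕ × List (Fin Q.D → ℤ))) (ch : List (Fin Q.D → ℤ)) (sc m : ℕ) :
    ∀ w, runFrom Q finT xh (dat.withCur (scSt base st ch false [])) ((List.range w).map (Task.pf sc m)) =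
      dat.withCur (scSt base st ch false []) := by
  intro w
  induction w with
  | zero => rfl
  | succ w ih =>
    rw [List.range_succ, List.map_append, List.map_singleton, runFrom_append, runFrom_cons, runFrom_nil, ih, step,
      upd_pf_false _ (by rw [Data.withCur_done]; exact hdone) rfl]

/-- **One chain slot** is one `chainStep` with the prefix-search choice. [cite: FournierKoiran2000, §2.1 (computing `E_{i+1}` from `E_i`)] -/
theorem run_slot (dat : Data Q.D) (hdone : dat.done = false) (base : Scratch Q.D)
    (st : Option (ℕ × List (Fin Q.D → ℤ))) (ch : List (Fin Q.D → ℤ)) (sc m : ℕ) :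
    let Λ : LevelCtx Q := ⟨dat.chart, dat.levels.map fun r => r.apex.1, base.m⟩
    runFrom Q finT xh (dat.withCur (scSt base st ch false [])) (Task.ex sc m :: (List.range Q.Wf).map (Task.pf sc m)) =
      dat.withCur (scSt base st (Λ.chainStep Λ.chooseForm sc ch) false []) := by
  classical
  intro Λ
  rw [runFrom_cons, step, truth_of_not_isSign _ _ rfl, upd_ex _ (by rw [Data.withCur_done]; exact hdone)]
  simp only [Data.withCur_cur, Data.withCur_withCur]
  rw [LevelCtx.chainStep]
  by_cases h : ∃ a z z', Λ.ValidTriple sc ch a z z'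
  · have hdec : decide (npTruth finT (certOf Q) (dat.withCur (scSt base st ch false [])) (Task.ex sc m)) = true :=
      decide_eq_true h
    rw [hdec, if_pos h]
    exact run_pf_active dat hdone base st ch sc m
  · have hdec : decide (npTruth finT (certOf Q) (dat.withCur (scSt base st ch false [])) (Task.ex sc m)) = false :=
      decide_eq_false h
    rw [hdec, if_neg h]
    exact run_pf_idle dat hdone base st ch sc m Q.Wf

/-- The slots of one scale build `chainBuild`. [cite: FournierKoiran2000, §2.1] -/
theorem run_slots (dat : Data Q.D) (hdone : dat.done = false) (base : Scratch Q.D)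
    (st : Option (ℕ × List (Fin Q.D → ℤ))) (sc : ℕ) :
    let Λ : LevelCtx Q := ⟨dat.chart, dat.levels.map fun r => r.apex.1, base.m⟩
    ∀ n, runFrom Q finT xh (dat.withCur (scSt base st [] false []))
        ((List.range n).flatMap fun m => Task.ex sc m :: (List.range Q.Wf).map (Task.pf sc m)) =
      dat.withCur (scSt base st (Λ.chainBuild Λ.chooseForm sc n) false []) := by
  intro Λ n
  induction n with
  | zero => rfl
  | succ n ih =>
    rw [show List.range (n + 1) = List.range n ++ [n] from List.range_succ, List.flatMap_append, runFrom_append, ih,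
      List.flatMap_singleton, run_slot dat hdone]
    rfl

/-- The stability record after scales `0, …, n-1`. [folklore] -/
noncomputable def stableAfter (Λ : LevelCtx Q) : ℕ → Option (ℕ × List (Fin Q.D → ℤ))
  | 0 => none
  | n + 1 =>
    match stableAfter Λ n with
    | some p => some p
    | none => by
      classical
      exact if Λ.Unstable Λ.chooseForm n then none else some (n, Λ.chainOf Λ.chooseForm n)

/-- **One scale**: the slots then the stability test. [cite: FournierKoiran2000, §2.1] -/
theorem run_scale (dat : Data Q.D) (hdone : dat.done = false) (base : Scratch Q.D) (n : ℕ) :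
    let Λ : LevelCtx Q := ⟨dat.chart, dat.levels.map fun r => r.apex.1, base.m⟩
    runFrom Q finT xh (dat.withCur (scSt base (stableAfter Λ n) [] false []))
        (((List.range (Q.D + 1)).flatMap fun m => Task.ex n m :: (List.range Q.Wf).map (Task.pf n m)) ++ [Task.st n]) =
      dat.withCur (scSt base (stableAfter Λ (n + 1)) [] false []) := by
  classical
  intro Λ
  rw [runFrom_append, run_slots dat hdone base _ n (Q.D + 1), runFrom_cons, runFrom_nil, step,
    truth_of_not_isSign _ _ rfl, upd_st _ (by rw [Data.withCur_done]; exact hdone)]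
  simp only [Data.withCur_cur, Data.withCur_withCur]
  have hnp : npTruth finT (certOf Q) (dat.withCur (scSt base (stableAfter Λ n) (Λ.chainBuild Λ.chooseForm n (Q.D + 1)) false []))
      (Task.st n) = Λ.Unstable Λ.chooseForm n := rfl
  rw [hnp]
  rw [show Λ.chainBuild Λ.chooseForm n (Q.D + 1) = Λ.chainOf Λ.chooseForm n from rfl]
  cases hst : stableAfter Λ n with
  | some p =>
    have : stableAfter Λ (n + 1) = some p := by rw [stableAfter, hst]
    rw [this]; rfl
  | none =>
    by_cases hu : Λ.Unstable Λ.chooseForm n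
    · have : stableAfter Λ (n + 1) = none := by
        rw [stableAfter, hst]; simp [hu]
      rw [this, decide_eq_true hu]; rfl
    · have : stableAfter Λ (n + 1) = some (n, Λ.chainOf Λ.chooseForm n) := by
        rw [stableAfter, hst]; simp [hu]
      rw [this, decide_eq_false hu]; rfl

/-- **All scales.** [cite: FournierKoiran2000, §2.1] -/
theorem run_scales (dat : Data Q.D) (hdone : dat.done = false) (base : Scratch Q.D) :
    let Λ : LevelCtx Q := ⟨dat.chart, dat.levels.map fun r => r.apex.1, base.m⟩
    ∀ n, runFrom Q finT xh (dat.withCur (scSt base none [] false []))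
        ((List.range n).flatMap fun sc =>
          ((List.range (Q.D + 1)).flatMap fun m => Task.ex sc m :: (List.range Q.Wf).map (Task.pf sc m)) ++ [Task.st sc]) =
      dat.withCur (scSt base (stableAfter Λ n) [] false []) := by
  intro Λ n
  induction n with
  | zero => rfl
  | succ n ih =>
    rw [show List.range (n + 1) = List.range n ++ [n] from List.range_succ, List.flatMap_append, runFrom_append, ih,
      List.flatMap_singleton]
    exact run_scale dat hdone base n

/-- `stableAfter` finds the stable scale. [folklore] -/
theorem stableAfter_eq (Λ : LevelCtx Q) (hs : Λ.SoundChoose Λ.chooseForm) (hW : Λ.WF) :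
    ∀ n, stableAfter Λ n =
      if Λ.scStar Λ.chooseForm < n then some (Λ.scStar Λ.chooseForm, Λ.chainOf Λ.chooseForm (Λ.scStar Λ.chooseForm))
      else none := by
  classical
  intro n
  induction n with
  | zero => simp [stableAfter]
  | succ n ih =>
    rw [stableAfter, ih]
    by_cases h : Λ.scStar Λ.chooseForm < n
    · rw [if_pos h, if_pos (show Λ.scStar Λ.chooseForm < n + 1 by omega)]
    · rw [if_neg h]
      simp only
      rcases Nat.lt_or_ge n (Λ.scStar Λ.chooseForm) with hlt | hge
      · rw [if_pos (Λ.unstable_of_lt_scStar hlt), if_neg (show ¬ Λ.scStar Λ.chooseForm < n + 1 by omega)]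
      · have heq : n = Λ.scStar Λ.chooseForm := by omega
        rw [if_neg (by rw [heq]; exact (Λ.scStar_spec hs hW).2), if_pos (show Λ.scStar Λ.chooseForm < n + 1 by omega), heq]

end SC

/-! ### Apex search -/

section AP

variable {Q}

/-- Update of an apex prefix task. [folklore] -/
theorem upd_ap (dat : Data Q.D) (hdone : dat.done = false) (w : ℕ) (b : Bool) :
    upd Q dat (Task.ap w) b =
      if w + 1 = Q.Wa then dat.withCur { dat.cur with apex := decodeApex Q.W Q.D (dat.cur.bits ++ [b]), bits := [] }
      else dat.withCur { dat.cur with bits := dat.cur.bits ++ [b] } := by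
  simp [upd, hdone, Data.withCur]

/-- **The apex phase** computes `chooseApex` at the recorded stable scale and chain.
[cite: FournierKoiran2000, §2.1 ("compute a point `s_n^1`"), here by prefix search] -/
theorem run_ap (dat : Data Q.D) (hdone : dat.done = false) (base : Scratch Q.D) (hbits : base.bits = [])
    (p : ℕ × List (Fin Q.D → ℤ)) (hst : base.stable = some p) :
    let Λ : LevelCtx Q := ⟨dat.chart, dat.levels.map fun r => r.apex.1, base.m⟩
    runFrom Q finT xh (dat.withCur base) ((List.range Q.Wa).map Task.ap) =
      dat.withCur { base with apex := Λ.chooseApex p.1 p.2, bits := [] } := by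
  intro Λ
  have key : ∀ w, w < Q.Wa →
      runFrom Q finT xh (dat.withCur base) ((List.range w).map Task.ap) =
        dat.withCur { base with bits := prefixSearch (Λ.ApexP p.1 p.2) Q.Wa w [] } := by
    intro w hw
    induction w with
    | zero => rw [List.range_zero, List.map_nil, runFrom_nil, prefixSearch, ← hbits]
    | succ w ih =>
      rw [List.range_succ, List.map_append, List.map_singleton, runFrom_append, runFrom_cons, runFrom_nil,
        ih (by omega), step, truth_of_not_isSign _ _ rfl, upd_ap _ (by rw [Data.withCur_done]; exact hdone),
        if_neg (by omega), prefixSearch_succ_right]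
      simp only [Data.withCur_cur, Data.withCur_withCur]
      have hnp : npTruth finT (certOf Q) (dat.withCur { base with bits := prefixSearch (Λ.ApexP p.1 p.2) Q.Wa w [] }) (Task.ap w) =
          ∃ w', Λ.ApexP p.1 p.2 w' ∧ w'.length = Q.Wa ∧ prefixSearch (Λ.ApexP p.1 p.2) Q.Wa w [] ++ [true] <+: w' := by
        simp only [npTruth, Data.withCur_cur, hst, Option.getD_some]
        rfl
      rw [hnp]
      rfl
  obtain ⟨W', hW'⟩ : ∃ W', Q.Wa = W' + 1 := ⟨Q.Wa - 1, by have := one_le_Wa (Q := Q); omega⟩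
  rw [hW', List.range_succ, List.map_append, List.map_singleton, runFrom_append, runFrom_cons, runFrom_nil,
    key W' (by omega), step, truth_of_not_isSign _ _ rfl,
    upd_ap _ (by rw [Data.withCur_done]; exact hdone), if_pos hW'.symm]
  simp only [Data.withCur_cur, Data.withCur_withCur]
  have hnp : npTruth finT (certOf Q) (dat.withCur { base with bits := prefixSearch (Λ.ApexP p.1 p.2) Q.Wa W' [] }) (Task.ap W') =
      ∃ w', Λ.ApexP p.1 p.2 w' ∧ w'.length = Q.Wa ∧ prefixSearch (Λ.ApexP p.1 p.2) Q.Wa W' [] ++ [true] <+: w' := by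
    simp only [npTruth, Data.withCur_cur, hst, Option.getD_some]
    rfl
  rw [hnp, LevelCtx.chooseApex, show Q.Wa = W' + 1 from hW', prefixSearch_succ_right]
  rfl

end AP

/-! ### Equality tests -/

section EQ

variable {Q}

/-- Update of the equality tests. [folklore] -/
theorem upd_eqGe (dat : Data Q.D) (hdone : dat.done = false) (i : Fin Q.D) (b : Bool) :
    upd Q dat (Task.eqGe i) b = dat.withCur { dat.cur with ge := Function.update dat.cur.ge i b } := by
  simp [upd, hdone, Data.withCur]

/-- Update of the equality tests. [folklore] -/
theorem upd_eqLe (dat : Data Q.D) (hdone : dat.done = false) (i : Fin Q.D) (b : Bool) :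
    upd Q dat (Task.eqLe i) b = dat.withCur { dat.cur with le := Function.update dat.cur.le i b } := by
  simp [upd, hdone, Data.withCur]

/-- **The equality-test phase** records the two sign bits of every coordinate. [cite: FournierKoiran2000, §2.1 (the test `x = s_n^k`)] -/
theorem run_eq (dat : Data Q.D) (hdone : dat.done = false) (base : Scratch Q.D) (g l : Fin Q.D → Bool)
    (hge : ∀ (ge le : Fin Q.D → Bool) (i : Fin Q.D),
      truth finT (certOf Q) xh (dat.withCur { base with ge := ge, le := le }) (Task.eqGe i) = g i)
    (hle : ∀ (ge le : Fin Q.D → Bool) (i : Fin Q.D),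
      truth finT (certOf Q) xh (dat.withCur { base with ge := ge, le := le }) (Task.eqLe i) = l i) :
    ∀ lst : List (Fin Q.D),
      runFrom Q finT xh (dat.withCur base) (lst.flatMap fun i => [Task.eqGe i, Task.eqLe i]) =
        dat.withCur { base with ge := fun i => if i ∈ lst then g i else base.ge i,
                                le := fun i => if i ∈ lst then l i else base.le i } := by
  intro lst
  induction lst using List.reverseRecOn with
  | nil =>
    simp only [List.flatMap_nil, runFrom_nil, List.not_mem_nil, if_false]
  | append_singleton lst i ih =>
    rw [List.flatMap_append, runFrom_append, ih, List.flatMap_singleton,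
      runFrom_cons, step, hge, upd_eqGe _ (by rw [Data.withCur_done]; exact hdone)]
    simp only [Data.withCur_cur, Data.withCur_withCur]
    rw [runFrom_cons, runFrom_nil, step, hle, upd_eqLe _ (by rw [Data.withCur_done]; exact hdone)]
    simp only [Data.withCur_cur, Data.withCur_withCur]
    congr 2
    · funext i'
      by_cases h : i' = i
      · subst h; simp
      · simp [h]
    · funext i'
      by_cases h : i' = i
      · subst h; simp
      · simp [h]

end EQ

/-! ### Facet comparisons -/

section FA

variable {Q}

/-- The fold realised by the facet phase: `valid i` is "free and moving", `b c i` the answer to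
"hitting parameter of `c` ≤ that of `i`?". [cite: FournierKoiran2000, §2.1] -/
def faFold (valid : Fin Q.D → Bool) (b : Fin Q.D → Fin Q.D → Bool) (cand : Option (Fin Q.D)) (i : Fin Q.D) : Option (Fin Q.D) :=
  match cand with
  | none => if valid i then some i else none
  | some c => if valid i && !(b c i) then some i else some c

/-- Update of a facet task. [folklore] -/
theorem upd_fa (dat : Data Q.D) (hdone : dat.done = false) (i : Fin Q.D) (bb : Bool) :
    upd Q dat (Task.fa i) bb = dat.withCur { dat.cur with cand :=
      (match dat.cur.cand with
        | none => if dat.validB i then some i else none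
        | some c => if dat.validB i && !bb then some i else some c) } := by
  -- case on the scrutinee, so that the two (module-local) matchers both reduce
  rcases hc : dat.cur.cand with _ | c
  · simp [upd, hdone, Data.withCur, hc]
  · simp [upd, hdone, Data.withCur, hc]

/-- `validB` only depends on the chart and the equality bits. [folklore] -/
theorem validB_withCur (dat : Data Q.D) (c : Scratch Q.D) (i : Fin Q.D) :
    (dat.withCur c).validB i = (decide (dat.chart i = 0) && decide (signOf (c.ge i) (c.le i) ≠ 0)) := rfl

/-- **The facet phase** realises `faFold` over the coordinates. [cite: FournierKoiran2000, §2.1 (choice of the face `f_n^k`)] -/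
theorem run_fa (dat : Data Q.D) (hdone : dat.done = false) (base : Scratch Q.D) (b : Fin Q.D → Fin Q.D → Bool)
    (htruth : ∀ (c i : Fin Q.D), (dat.withCur base).validB i = true →
      truth finT (certOf Q) xh (dat.withCur { base with cand := some c }) (Task.fa i) = b c i) :
    ∀ lst : List (Fin Q.D),
      runFrom Q finT xh (dat.withCur base) (lst.map Task.fa) =
        dat.withCur { base with cand := lst.foldl (faFold ((dat.withCur base).validB) b) base.cand } := by
  intro lst
  induction lst using List.reverseRecOn with
  | nil => rfl
  | append_singleton lst i ih =>
    rw [List.map_append, runFrom_append, ih, List.map_singleton, runFrom_cons, runFrom_nil, step,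
      upd_fa _ (by rw [Data.withCur_done]; exact hdone), List.foldl_append, List.foldl_cons, List.foldl_nil]
    simp only [Data.withCur_cur, Data.withCur_withCur]
    congr 2
    have hvc : ∀ x : Option (Fin Q.D), (dat.withCur { base with cand := x }).validB i = (dat.withCur base).validB i :=
      fun _ => rfl
    rw [hvc]
    cases hc : List.foldl (faFold (dat.withCur base).validB b) base.cand lst with
    | none => rfl
    | some c =>
      cases hv : (dat.withCur base).validB i with
      | false => simp [faFold, hv]
      | true =>
        have ht := htruth c i hv
        simp only [faFold, hv, Bool.true_and]
        rw [show (dat.withCur { base with cand := some c }) = dat.withCur { base with cand := some c } from rfl] at ht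
        rw [ht]

/-- The closing task finishes the level. [folklore] -/
theorem run_close (dat : Data Q.D) (hdone : dat.done = false) :
    runFrom Q finT xh dat [Task.close] = finishLevel Q dat := by
  rw [runFrom_cons, runFrom_nil, step]
  simp [upd, hdone]

end FA

end FKPointLocation

end Literature.Computability.Complexity
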